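import Summits.AtomisticToContinuum.Crystallization.Theses.ChessboardParticlePlanes
import Summits.AtomisticToContinuum.Crystallization.Theorems.LaminarSixThreeThreeHcpWindowsToPeriodicWindows
import Literature.MathematicalPhysics.StatisticalMechanics.MuGroundStateConfiguration
import Literature.MathematicalPhysics.StatisticalMechanics.BarlowStacking

/-!
# Crux `PeriodicWindows` (stmt-AtomisticToContinuum-3240), line `Sketch` — stub S4b

Stub `stub_hcpWindowsLimit`, step S4b of the lead skeleton `PeriodicWindowsSketch` (compactness,
no physics): if the sets `Xs k ⊆ ℝ³` are two-way `1/(k+1)`-matched on the `k`-ball about `0`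
(`BallMatch`) with relaxed hexagonal close packings `hcpStacking (a k) (h k)` whose spacings lie in
the box `[1/2, 2]²`, then along a subsequence `φ` the `Xs (φ k)` converge locally (two-way
`ε`-matching on every `R`-ball, eventually in `k`) to ONE stacking `hcpStacking a₀ h₀`,
`(a₀, h₀) ∈ [1/2, 2]²`.

Proof: extract `(a (φ k), h (φ k)) → (a₀, h₀)` in the compact box (`IsCompact.tendsto_subseq`);
Barlow positions move Lipschitz in the spacings on bounded windows
(`exists_mem_hcpStacking_norm_sub_le`: a site `q` of `hcpStacking a h`, `a, h ≥ 1/2`, has a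
partner `q'` in `hcpStacking a' h'` with `‖q' - q‖ ≤ 2 (|a' - a| + |h' - h|) ‖q‖`), so on the
`R`-ball the sites of `hcpStacking a₀ h₀` and of `hcpStacking (a (φ k)) (h (φ k))` are mutually
`ε/2`-close once `|a (φ k) - a₀|, |h (φ k) - h₀| < ε / (16 (R + 1))`; composing with the
`1/(φ k + 1)`-matching at scale `φ k ≥ R + 1` gives the `ε`-matching (for `ε ≤ 1`; larger `ε` by
monotonicity, `BallMatch.mono`).
-/

noncomputable section

namespace Summit.AtomisticToContinuum.Crystallization.Theorems.PeriodicWindowsSketch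

open Literature.MathematicalPhysics.StatisticalMechanics Filter

/-- STUB S4b (compactness, provable now): if `Xs k` is two-way `1/(k+1)`-matched on the `k`-ball
about `0` with `hcpStacking (a k) (h k)`, spacings in `[1/2, 2]²`, then along a subsequence the `Xs`
converge locally to ONE `hcpStacking a₀ h₀` (extract `(a, h) → (a₀, h₀)`; Barlow positions move
Lipschitz in the spacings on bounded windows, `exists_mem_hcpStacking_norm_sub_le`). -/
theorem stub_hcpWindowsLimit (Xs : ℕ → Set (EuclideanSpace ℝ (Fin 3))) (a h : ℕ → ℝ)
    (ha : ∀ k, 1 / 2 ≤ a k ∧ a k ≤ 2) (hh : ∀ k, 1 / 2 ≤ h k ∧ h k ≤ 2)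
    (hwin : ∀ k : ℕ, BallMatch (1 / ((k : ℝ) + 1)) k 0 (Xs k) (hcpStacking (a k) (h k))) :
    ∃ (φ : ℕ → ℕ) (a₀ h₀ : ℝ), StrictMono φ ∧ 1 / 2 ≤ a₀ ∧ a₀ ≤ 2 ∧ 1 / 2 ≤ h₀ ∧ h₀ ≤ 2 ∧
      ∀ R ε : ℝ, 0 < ε → ∀ᶠ k in Filter.atTop, BallMatch ε R 0 (Xs (φ k)) (hcpStacking a₀ h₀) := by
  -- Step 1: compactness of the box `[1/2, 2]²` and a convergent subsequence of the spacings.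
  have hK : IsCompact (Set.Icc (1 / 2 : ℝ) 2 ×ˢ Set.Icc (1 / 2 : ℝ) 2) :=
    isCompact_Icc.prod isCompact_Icc
  have hu : ∀ k, (fun k => (a k, h k)) k ∈ Set.Icc (1 / 2 : ℝ) 2 ×ˢ Set.Icc (1 / 2 : ℝ) 2 :=
    fun k => ⟨ha k, hh k⟩
  obtain ⟨⟨a₀, h₀⟩, ⟨⟨ha₀, ha₀'⟩, ⟨hh₀, hh₀'⟩⟩, φ, hφ, hlim⟩ := hK.tendsto_subseq hu
  have hlim_a : Tendsto (fun k => a (φ k)) atTop (nhds a₀) := hlim.fst_nhds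
  have hlim_h : Tendsto (fun k => h (φ k)) atTop (nhds h₀) := hlim.snd_nhds
  refine ⟨φ, a₀, h₀, hφ, ha₀, ha₀', hh₀, hh₀', fun R ε hε => ?_⟩
  -- Step 2: the scales `R' = max R 0 + 1`, `ε₁ = min ε 1`, `η = ε₁ / (8 R')`, and the large `k`.
  set R' : ℝ := max R 0 + 1 with hR'
  have hR0 : 0 ≤ max R 0 := le_max_right _ _
  have hRR : R ≤ max R 0 := le_max_left _ _
  have hR'pos : 0 < R' := by positivity
  set ε₁ : ℝ := min ε 1 with hε₁
  have hε₁pos : 0 < ε₁ := lt_min hε one_pos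
  have hε₁ε : ε₁ ≤ ε := min_le_left _ _
  have hε₁1 : ε₁ ≤ 1 := min_le_right _ _
  set η : ℝ := ε₁ / (8 * R') with hη
  have hηpos : 0 < η := by positivity
  have hηR' : 2 * (η + η) * R' = ε₁ / 2 := by
    rw [hη]
    field_simp
    ring
  filter_upwards [tendsto_natCast_atTop_atTop.eventually_ge_atTop R',
    tendsto_natCast_atTop_atTop.eventually_ge_atTop (2 / ε₁),
    Metric.tendsto_nhds.1 hlim_a η hηpos, Metric.tendsto_nhds.1 hlim_h η hηpos] with k hkR hkε hka hkh
  rw [Real.dist_eq] at hka hkh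
  set n := φ k with hn
  have hkn : (k : ℝ) ≤ n := by exact_mod_cast hφ.id_le k
  have hnR : R' ≤ (n : ℝ) := hkR.trans hkn
  have h2 : 2 ≤ ε₁ * k := (div_le_iff₀' hε₁pos).1 hkε
  have hεn : 1 / ((n : ℝ) + 1) ≤ ε₁ / 2 := by
    rw [div_le_div_iff₀ (by positivity) two_pos]
    have : ε₁ * k ≤ ε₁ * n := mul_le_mul_of_nonneg_left hkn hε₁pos.le
    linarith
  -- Step 3: the two-way matching at tolerance `ε₁ = min ε 1` on the `R`-ball, then monotonicity.
  refine (?_ : BallMatch ε₁ R 0 (Xs n) (hcpStacking a₀ h₀)).mono hε₁ε le_rfl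
  refine ⟨fun s hs hsR => ?_, fun x hx hxR => ?_⟩
  · -- every site of `hcpStacking a₀ h₀` in the ball is `ε₁`-close to a point of `Xs n`
    rw [dist_zero_right] at hsR
    have hsR' : ‖s‖ ≤ R' := by linarith
    obtain ⟨s', hs', hss'⟩ := exists_mem_hcpStacking_norm_sub_le ha₀ hh₀ (a n) (h n) hs
    have hd : ‖s' - s‖ ≤ ε₁ / 2 :=
      calc ‖s' - s‖ ≤ 2 * (|a n - a₀| + |h n - h₀|) * ‖s‖ := hss'
        _ ≤ 2 * (η + η) * R' := by gcongr
        _ = ε₁ / 2 := hηR'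
    have hs'n : dist s' 0 ≤ (n : ℝ) := by
      rw [dist_zero_right]
      have h1 : ‖s'‖ ≤ ‖s‖ + ‖s' - s‖ := norm_le_insert' s' s
      linarith
    obtain ⟨x, hx, hxs'⟩ := (hwin n).1 s' hs' hs'n
    refine ⟨x, hx, ?_⟩
    calc dist x s ≤ dist x s' + dist s' s := dist_triangle _ _ _
      _ ≤ ε₁ / 2 + ε₁ / 2 := add_le_add (hxs'.trans hεn) (by rwa [dist_eq_norm])
      _ = ε₁ := add_halves _
  · -- every point of `Xs n` in the ball is `ε₁`-close to a site of `hcpStacking a₀ h₀`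
    have hxn : dist x 0 ≤ (n : ℝ) := by linarith
    obtain ⟨s', hs', hxs'⟩ := (hwin n).2 x hx hxn
    have hxs'2 : dist x s' ≤ ε₁ / 2 := hxs'.trans hεn
    have hs'R' : ‖s'‖ ≤ R' := by
      have h1 : dist s' 0 ≤ dist x s' + dist x 0 := dist_triangle_left _ _ _
      rw [dist_zero_right] at h1
      linarith
    obtain ⟨s, hs, hss'⟩ := exists_mem_hcpStacking_norm_sub_le (ha n).1 (hh n).1 a₀ h₀ hs'
    have hd : ‖s - s'‖ ≤ ε₁ / 2 :=
      calc ‖s - s'‖ ≤ 2 * (|a₀ - a n| + |h₀ - h n|) * ‖s'‖ := hss'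
        _ ≤ 2 * (η + η) * R' := by
            rw [abs_sub_comm a₀, abs_sub_comm h₀]
            gcongr
        _ = ε₁ / 2 := hηR'
    refine ⟨s, hs, ?_⟩
    calc dist x s ≤ dist x s' + dist s' s := dist_triangle _ _ _
      _ ≤ ε₁ / 2 + ε₁ / 2 := add_le_add hxs'2 (by rwa [dist_comm, dist_eq_norm])
      _ = ε₁ := add_halves _

end Summit.AtomisticToContinuum.Crystallization.Theorems.PeriodicWindowsSketch

end
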